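import Literature.NumberTheory.Automorphic.EichlerOrderLocalGlobal
import Literature.NumberTheory.Automorphic.EichlerOrderPadicSplitting
import Literature.NumberTheory.Automorphic.BrandtModuleDictionary
import Literature.NumberTheory.Automorphic.QuaternionMaximalOrder
import Literature.NumberTheory.Automorphic.QuaternionAlgebraExistenceReciprocity
import HarnessLib

/-!
# Eichler packages exist at admissible levels: proof of the named fact `nonempty_eichlerPackage`
# (Vignéras, LNM 800, Ch. III §3 Thm. 3.1, Ch. I §4 Prop. 4.2, Ch. II §2, Ch. III §5 Prop. 5.1)

Sibling proof file of `Literature/NumberTheory/Automorphic/BrandtModule.lean` (namespace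
`Literature.NumberTheory.Automorphic`; next to `BrandtModuleProofs.lean`, which discharges
`brandtMatrix_mul_of_coprime`), discharging its named fact

> `nonempty_eichlerPackage : ∀ N⁺ N⁻, 0 < N⁺ → Squarefree N⁻ → Odd ω(N⁻) → gcd(N⁺, N⁻) = 1 →
>   Nonempty (EichlerPackage N⁺ N⁻)`

— for `N⁺ ≥ 1` and `N⁻` squarefree with an odd number of prime factors, coprime to `N⁺`, there is
a definite quaternion algebra over `ℚ` ramified exactly at the primes dividing `N⁻` containing an
Eichler order of level `N⁺` — along the lines of its docstring ("Ingredients, all in Vignéras"):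

1. **the algebra** (III §3 Thm. 3.1, existence; the tree's theorem
   `exists_isQuaternionAlgebra_of_even_rat`): ramification set `S = {v : N⁻ ∈ v}` (`ω(N⁻)`
   finite places, `exists_finset_places_dvd`) and `T = {∞}` (the unique, real, infinite place of
   `ℚ`), `|S| + |T| = ω(N⁻) + 1` even; the algebra is then totally definite, hence a division
   algebra (`isUnit_of_isTotallyDefinite`);
2. **a maximal order** `O₁` (I §4 Prop. 4.2; the tree's `exists_isMaximalOrder` of
   `QuaternionMaximalOrder.lean`, transported by `isMaximalZOrder_iff_isMaximalOrder` of
   `BrandtModuleDictionary.lean`);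
3. **the local data at `p ∣ N⁺`**: `p ∤ N⁻` (coprimality), so the algebra is split at `p`, and
   `exists_modPow_reduction` (`EichlerOrderPadicSplitting.lean`: II §2 Thm. 2.3 (1) with III §5,
   the completion of `O₁` at `p` is `≅ M₂(ℤ_p)`) gives the reductions
   `ψ_p : O₁ ↠ M₂(ℤ/p^{v_p(N⁺)+1})` with kernel `p^{v_p(N⁺)+1} O₁`;
4. **the Eichler order** `O₁ ∩ O₂` of level `N⁺` (II §2: locally `M₂(ℤ_p) ∩ g M₂(ℤ_p) g⁻¹`,
   `g = diag(1, p^{v_p N⁺})`; III §5 Prop. 5.1: patched into the global maximal order `O₂`):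
   `exists_isEichlerOrder_of_modPow` (`EichlerOrderLocalGlobal.lean`).

## References

* M.-F. Vignéras, *Arithmétique des algèbres de quaternions*, LNM 800 (1980), Ch. I §4
  Prop. 4.2, Ch. II §2 (Lemme 2.1, Thm. 2.3, ordres d'Eichler de niveau `p^n`), Ch. III §3
  Thm. 3.1, Ch. III §5 Prop. 5.1 [VignerasLNM800].
-/

noncomputable section

open NumberField IsDedekindDomain
open scoped TensorProduct

namespace Literature.NumberTheory.Automorphic

/-- **The finite places of `ℚ` above the primes dividing `n ≠ 0`** form a finite set of
cardinality `ω(n)` (the bijection `Rat.HeightOneSpectrum.primesEquiv` between finite places of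
`ℚ` and prime numbers, with `p_v ∣ n ↔ (n) ⊆ v`, `primesEquiv_dvd_iff`). [folklore] -/
theorem exists_finset_places_dvd (n : ℕ) (hn : n ≠ 0) :
    ∃ S : Finset (HeightOneSpectrum (𝓞 ℚ)),
      (∀ v, v ∈ S ↔ ((n : ℕ) : 𝓞 ℚ) ∈ v.asIdeal) ∧ S.card = n.primeFactors.card := by
  classical
  let f : n.primeFactors → HeightOneSpectrum (𝓞 ℚ) := fun q =>
    (Rat.HeightOneSpectrum.primesEquiv (R := 𝓞 ℚ)).symm ⟨q.1, Nat.prime_of_mem_primeFactors q.2⟩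
  have hf : Function.Injective f := by
    intro a b h
    have h' := congrArg (fun v => ((Rat.HeightOneSpectrum.primesEquiv v : Nat.Primes) : ℕ)) h
    simp only [f, Equiv.apply_symm_apply] at h'
    exact Subtype.ext h'
  refine ⟨Finset.univ.image f, fun v => ?_, ?_⟩
  · rw [Finset.mem_image, ← primesEquiv_dvd_iff]
    constructor
    · rintro ⟨q, -, rfl⟩
      simp only [f, Equiv.apply_symm_apply]
      exact Nat.dvd_of_mem_primeFactors q.2
    · intro hdvd
      refine ⟨⟨(Rat.HeightOneSpectrum.primesEquiv v : ℕ), Nat.mem_primeFactors.mpr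
        ⟨(Rat.HeightOneSpectrum.primesEquiv v).2, hdvd, hn⟩⟩, Finset.mem_univ _, ?_⟩
      simp only [f, Subtype.coe_eta, Equiv.symm_apply_apply]
  · rw [Finset.card_image_of_injective _ hf, Finset.card_univ, Fintype.card_coe]

/-- **Existence of Eichler packages at admissible levels** — the named fact
`nonempty_eichlerPackage` of `BrandtModule.lean` holds: for `N⁺ ≥ 1` and `N⁻` squarefree with an
odd number of prime factors, coprime to `N⁺`, there is a definite quaternion algebra over `ℚ`
ramified exactly at the primes dividing `N⁻` (Vignéras III §3 Thm. 3.1 over `ℚ`, the tree's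
`exists_isQuaternionAlgebra_of_even_rat`, with `S = {v ∋ N⁻}`, `T = {∞}`, `|S| + |T|` even)
containing an Eichler order of level `N⁺` (a maximal order `O₁`, I §4 Prop. 4.2, intersected
with the maximal order `O₂` which is `diag(1, p^{v_p N⁺})`-conjugate to `O₁` at each `p ∣ N⁺` —
these primes are split as `p ∤ N⁻` — and equal to `O₁` elsewhere, II §2 and III §5 Prop. 5.1:
`exists_modPow_reduction`, `exists_isEichlerOrder_of_modPow`). [cite: VignerasLNM800, Ch. III §3 Thm. 3.1, Ch. I §4 Prop. 4.2, Ch. II §2 Thm. 2.3 and Lemme 2.4, Ch. III §5 Prop. 5.1] -/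
theorem nonempty_eichlerPackage_holds : nonempty_eichlerPackage := by
  intro Nplus Nminus h0 hsq hodd hcop
  classical
  have hNm : Nminus ≠ 0 := Squarefree.ne_zero hsq
  obtain ⟨S, hS, hScard⟩ := exists_finset_places_dvd Nminus hNm
  -- 1. the quaternion algebra, ramified exactly at `S` and at `∞`
  have hT : ∀ w ∈ (Finset.univ : Finset (InfinitePlace ℚ)), w.IsReal := fun w _ =>
    IsTotallyReal.isReal w
  have heven : Even (S.card + (Finset.univ : Finset (InfinitePlace ℚ)).card) := by
    rw [hScard, Finset.card_univ, Fintype.card_unique]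
    exact hodd.add_one
  obtain ⟨D, _, _, hD, hram, hraminf⟩ :=
    exists_isQuaternionAlgebra_of_even_rat S Finset.univ hT heven
  have hdef : IsTotallyDefinite ℚ D := fun w => by
    have hw : w ∈ ramifiedInfinitePlaces ℚ D := by
      rw [hraminf, Finset.coe_univ]
      exact Set.mem_univ w
    exact hw
  have hdiv : ∀ x : D, x ≠ 0 → IsUnit x := fun x hx => isUnit_of_isTotallyDefinite D hdef hx
  -- 2. a maximal order
  obtain ⟨O₁, hO₁⟩ := exists_isMaximalOrder hdiv
  have hO₁' : IsMaximalZOrder O₁ := isMaximalZOrder_iff_isMaximalOrder.mpr hO₁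
  -- 3. the reductions at the primes dividing `N⁺` (which are split)
  have hψ : ∀ p ∈ Nplus.primeFactors,
      ∃ ψ : D → Matrix (Fin 2) (Fin 2) (ZMod (p ^ (Nplus.factorization p + 1))),
        (∀ x ∈ O₁, ∀ y ∈ O₁, ψ (x + y) = ψ x + ψ y) ∧
        (∀ x ∈ O₁, ∀ y ∈ O₁, ψ (x * y) = ψ x * ψ y) ∧ ψ 1 = 1 ∧
        (∀ m, ∃ x ∈ O₁, ψ x = m) ∧
        (∀ x ∈ O₁, ψ x = 0 ↔ ∃ y ∈ O₁, x = ((p : ℤ) ^ (Nplus.factorization p + 1)) • y) := by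
    intro p hp
    have hpp : p.Prime := Nat.prime_of_mem_primeFactors hp
    haveI : Fact p.Prime := ⟨hpp⟩
    set v : HeightOneSpectrum (𝓞 ℚ) :=
      (Rat.HeightOneSpectrum.primesEquiv (R := 𝓞 ℚ)).symm ⟨p, hpp⟩ with hv
    have hvp : ((Rat.HeightOneSpectrum.primesEquiv v : Nat.Primes) : ℕ) = p := by
      rw [hv, Equiv.apply_symm_apply]
    have hsplit : IsSplitAt D v := by
      by_contra hns
      have hvr : v ∈ ramifiedPlaces ℚ D := hns
      rw [hram, Finset.mem_coe, hS, ← primesEquiv_dvd_iff, hvp] at hvr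
      have h1 : p ∣ Nat.gcd Nplus Nminus := Nat.dvd_gcd (Nat.dvd_of_mem_primeFactors hp) hvr
      rw [hcop.gcd_eq_one, Nat.dvd_one] at h1
      exact hpp.ne_one h1
    obtain ⟨e⟩ := nonempty_algEquiv_padic_of_isSplitAt D v hsplit p hvp
    exact exists_modPow_reduction hO₁' ⟨e⟩ _
  -- 4. the Eichler order of level `N⁺`
  obtain ⟨O, hO, -⟩ := exists_isEichlerOrder_of_modPow hdiv hO₁' h0.ne' hψ
  exact ⟨{ B := D
           isTotallyDefinite := hdef
           mem_ramifiedPlaces_iff := fun v => by rw [hram, Finset.mem_coe, hS]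
           O := O
           isEichlerOrder := hO }⟩

end Literature.NumberTheory.Automorphic
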